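import Summits.HodgeConjecture.HodgeConjecture.Theorems.PadicSemiregularLiftFermatAnchorAssemblyEulerCoords
import Summits.HodgeConjecture.HodgeConjecture.Theorems.PadicSemiregularLiftFermatAnchorAssemblyGMFBaseChange
import Mathlib.LinearAlgebra.FiniteDimensional.Lemmas

/-!
# The `ℤ`-graded Hom complex of a pair of graded matrix factorizations, III: `homDim` as ranks (line `witt-lift-rigid-mf`)

Crux `FermatAnchorAssembly` (stmt-HodgeConjecture-14874), stub `stub_eulerBaseChange`; continues
`…EulerCochains.lean`, `…EulerCoords.lean`.

For a LAWFUL pair `(M, N)` over a field `F`, the vocabulary's `homDim F L t M N` (closed even cochains of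
twist `t` modulo null-homotopic ones) and `homDim F L t M N[1]` are expressed through three numbers:
the dimension of the cochain spaces and the ranks `dRank t` of the even differential `dMap` on even
cochains of twist `t` and `hRank t` of the odd differential `hMap` on odd cochains of twist `t`:

* `homDim_add_ranks`: `homDim t M N + dRank t + hRank t = dim cochainSub t` (rank–nullity twice, `null ⊆ closed`);
* `homDim_shift_add_ranks`: `homDim t M N[1] + dRank t + hRank (t + m) = dim oddSub (t + m)` — the even
  cochains into `N[1]` are the odd cochains into `N` of twist `t + m`, and under `(s, u) ↦ (s, −u)` the
  differentials of the pair `(M, N[1])` are those of `(M, N)` (`dMap_shift_apply`, `hMap_shift_apply`), so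
  `closed(M, N[1])_t ≅ oddSub_{t+m} ∩ ker hMap` and `null(M, N[1])_t ≅ dMap (cochainSub_t)`.

Consequently the summand of the Euler form is `dim C_{jm} − dim C'_{(j+1)m} − hRank_{jm} + hRank_{(j+1)m}`
(`eulerSummand_eq`): the even rank CANCELS, which is what makes the base-change comparison a telescoping
argument. All `[folklore]`; no named fact, no `sorry`.
-/

-- `Summit.HodgeConjecture.HodgeConjecture.…` is the tree's mandated summit/problem namespace (single-problem summit).
set_option linter.dupNamespace false

noncomputable section

open Finset Module

namespace Summit.HodgeConjecture.HodgeConjecture.Cruxes.FermatAnchorAssembly.WittLiftRigidMf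

variable {ν m : ℕ}

/-! ### Two rank–nullity bookkeeping lemmas -/

section LinearAlgebra

variable {F : Type} [Field F] {V W : Type} [AddCommGroup V] [Module F V] [AddCommGroup W] [Module F W]

/-- `dim (X / Y) + dim Y = dim X` for `Y ≤ X` (with `Y` pulled back into `X`). [folklore] -/
theorem finrank_quotient_comap_add (X Y : Submodule F V) [Module.Finite F X] (h : Y ≤ X) :
    finrank F (X ⧸ Y.comap X.subtype) + finrank F Y = finrank F X := by
  rw [← (Submodule.comapSubtypeEquivOfLe h).finrank_eq]
  exact Submodule.finrank_quotient_add_finrank _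

/-- `dim (X ∩ ker f) + dim f(X) = dim X`. [folklore] -/
theorem finrank_inf_ker_add_finrank_map (X : Submodule F V) [Module.Finite F X] (f : V →ₗ[F] W) :
    finrank F ↥(X ⊓ LinearMap.ker f) + finrank F (X.map f) = finrank F X := by
  have key := LinearMap.finrank_range_add_finrank_ker (f.domRestrict X)
  rw [LinearMap.range_domRestrict, LinearMap.ker_domRestrict] at key
  have hc : (LinearMap.ker f).comap X.subtype = (X ⊓ LinearMap.ker f).comap X.subtype := by
    rw [Submodule.comap_inf, Submodule.comap_subtype_self, top_inf_eq]
  rw [hc, (Submodule.comapSubtypeEquivOfLe (inf_le_left : X ⊓ LinearMap.ker f ≤ X)).finrank_eq] at key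
  omega

/-- The sign involution `(x, y) ↦ (x, −y)` of a product module. [folklore] -/
def negSnd (A : Type) [CommRing A] {X Y : Type} [AddCommGroup X] [AddCommGroup Y] [Module A X]
    [Module A Y] : (X × Y) ≃ₗ[A] (X × Y) where
  toFun z := (z.1, -z.2)
  invFun z := (z.1, -z.2)
  map_add' z z' := by simp only [Prod.fst_add, Prod.snd_add, neg_add, Prod.mk_add_mk]
  map_smul' a z := by simp only [Prod.smul_fst, Prod.smul_snd, smul_neg, RingHom.id_apply, Prod.smul_mk]
  left_inv z := by simp
  right_inv z := by simp

/-- Formula for `negSnd`. [folklore] -/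
@[simp] theorem negSnd_apply (A : Type) [CommRing A] {X Y : Type} [AddCommGroup X] [AddCommGroup Y]
    [Module A X] [Module A Y] (z : X × Y) : negSnd A z = (z.1, -z.2) := rfl

/-- `negSnd` is an involution. [folklore] -/
@[simp] theorem negSnd_negSnd (A : Type) [CommRing A] {X Y : Type} [AddCommGroup X] [AddCommGroup Y]
    [Module A X] [Module A Y] (z : X × Y) : negSnd A (negSnd A z) = z := by
  simp

/-- `negSnd` is its own inverse. [folklore] -/
@[simp] theorem negSnd_symm_apply (A : Type) [CommRing A] {X Y : Type} [AddCommGroup X]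
    [AddCommGroup Y] [Module A X] [Module A Y] (z : X × Y) : (negSnd A).symm z = (z.1, -z.2) := rfl

end LinearAlgebra

namespace GMFData

variable {A : Type} [CommRing A] {ι₀ ι₁ κ₀ κ₁ : Type}

/-! ### The differentials of `(M, N[1])` are those of `(M, N)` up to the sign `u ↦ −u` -/

section Shift

variable [Fintype ι₀] [Fintype ι₁] [Fintype κ₀] [Fintype κ₁]

/-- `dMap M N[1] (s, u) = (id × (−1)) (hMap M N (s, −u))`. [folklore] -/
theorem dMap_shift_apply (M : GMFData A ν m ι₀ ι₁) (N : GMFData A ν m κ₀ κ₁)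
    (z : Matrix κ₁ ι₀ (MvPolynomial (Fin ν) A) × Matrix κ₀ ι₁ (MvPolynomial (Fin ν) A)) :
    dMap M N.shift z = negSnd A (hMap M N (negSnd A z)) := by
  obtain ⟨s, u⟩ := z
  simp only [dMap_apply, hMap_apply, negSnd_apply, Matrix.neg_mul, Matrix.mul_neg, neg_add_rev,
    neg_neg, Prod.mk.injEq]
  constructor
  · change N.φ * s - u * M.ψ = _
    abel
  · change N.ψ * u - s * M.φ = _
    abel

/-- `hMap M N[1] (a, b) = (id × (−1)) (dMap M N (a, −b))`. [folklore] -/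
theorem hMap_shift_apply (M : GMFData A ν m ι₀ ι₁) (N : GMFData A ν m κ₀ κ₁)
    (z : Matrix κ₀ ι₀ (MvPolynomial (Fin ν) A) × Matrix κ₁ ι₁ (MvPolynomial (Fin ν) A)) :
    hMap M N.shift z = negSnd A (dMap M N (negSnd A z)) := by
  obtain ⟨a, b⟩ := z
  simp only [dMap_apply, hMap_apply, negSnd_apply, Matrix.neg_mul, Matrix.mul_neg, neg_sub,
    sub_neg_eq_add, Prod.mk.injEq]
  constructor
  · change b * M.ψ + N.ψ * a = _
    abel
  · change a * M.φ + N.φ * b = _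
    abel

end Shift

/-- `negSnd` preserves even cochains. [folklore] -/
theorem negSnd_mem_cochainSub {L : AddSubgroup (Fin ν → ZMod m)} {t : ℤ} {M : GMFData A ν m ι₀ ι₁}
    {N : GMFData A ν m κ₀ κ₁}
    {z : Matrix κ₀ ι₀ (MvPolynomial (Fin ν) A) × Matrix κ₁ ι₁ (MvPolynomial (Fin ν) A)} :
    negSnd A z ∈ cochainSub L t M N ↔ z ∈ cochainSub L t M N := by
  constructor
  · rintro ⟨ha, hb⟩
    refine ⟨ha, fun l j ↦ ?_⟩
    simpa using (hb l j).neg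
  · rintro ⟨ha, hb⟩
    exact ⟨ha, fun l j ↦ (hb l j).neg⟩

/-- `negSnd` preserves odd cochains. [folklore] -/
theorem negSnd_mem_oddSub {L : AddSubgroup (Fin ν → ZMod m)} {t : ℤ} {M : GMFData A ν m ι₀ ι₁}
    {N : GMFData A ν m κ₀ κ₁}
    {z : Matrix κ₁ ι₀ (MvPolynomial (Fin ν) A) × Matrix κ₀ ι₁ (MvPolynomial (Fin ν) A)} :
    negSnd A z ∈ oddSub L t M N ↔ z ∈ oddSub L t M N := by
  constructor
  · rintro ⟨hs, hu⟩
    refine ⟨hs, fun k j ↦ ?_⟩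
    simpa using (hu k j).neg
  · rintro ⟨hs, hu⟩
    exact ⟨hs, fun k j ↦ (hu k j).neg⟩

/-! ### Ranks of the differentials; `homDim` as ranks -/

variable {F : Type} [Field F] [Fintype ι₀] [Fintype ι₁] [Fintype κ₀] [Fintype κ₁]

/-- `span closedSet = closedSub` (the set is already a subspace). [folklore] -/
theorem span_closedSet (L : AddSubgroup (Fin ν → ZMod m)) (t : ℤ) (M : GMFData A ν m ι₀ ι₁)
    (N : GMFData A ν m κ₀ κ₁) : Submodule.span A (closedSet m L t M N) = closedSub L t M N := by
  rw [← coe_closedSub, Submodule.span_eq]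

/-- `span nullSet = nullSub` (the set is already a subspace). [folklore] -/
theorem span_nullSet (L : AddSubgroup (Fin ν → ZMod m)) (t : ℤ) (M : GMFData A ν m ι₀ ι₁)
    (N : GMFData A ν m κ₀ κ₁) : Submodule.span A (nullSet m L t M N) = nullSub L t M N := by
  rw [← coe_nullSub, Submodule.span_eq]

/-- The RANK OF THE EVEN DIFFERENTIAL on even cochains of twist `t`: `dim dMap (cochainSub t)`. [folklore] -/
def dRank (L : AddSubgroup (Fin ν → ZMod m)) (t : ℤ) (M : GMFData F ν m ι₀ ι₁)
    (N : GMFData F ν m κ₀ κ₁) : ℕ :=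
  finrank F ((cochainSub L t M N).map ((dMap M N).restrictScalars F))

/-- The RANK OF THE ODD DIFFERENTIAL on odd cochains of twist `t`: `dim hMap (oddSub t) = dim nullSub t`. [folklore] -/
def hRank (L : AddSubgroup (Fin ν → ZMod m)) (t : ℤ) (M : GMFData F ν m ι₀ ι₁)
    (N : GMFData F ν m κ₀ κ₁) : ℕ :=
  finrank F (nullSub L t M N)

/-- Closed cochains are finite-dimensional. [folklore] -/
instance closedSub_finite [Finite ι₀] [Finite ι₁] [Finite κ₀] [Finite κ₁]
    (L : AddSubgroup (Fin ν → ZMod m)) (t : ℤ) (M : GMFData F ν m ι₀ ι₁) (N : GMFData F ν m κ₀ κ₁) :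
    Module.Finite F (closedSub L t M N) :=
  Submodule.finiteDimensional_of_le (inf_le_left : closedSub L t M N ≤ cochainSub L t M N)

/-- `closedSub = cochainSub ⊓ ker (dMap as an F-linear map)`. [folklore] -/
theorem closedSub_eq_inf_ker (L : AddSubgroup (Fin ν → ZMod m)) (t : ℤ) (M : GMFData F ν m ι₀ ι₁)
    (N : GMFData F ν m κ₀ κ₁) :
    closedSub L t M N = cochainSub L t M N ⊓ LinearMap.ker ((dMap M N).restrictScalars F) := by
  rw [LinearMap.ker_restrictScalars]
  rfl

/-- `dim closedSub t + dRank t = dim cochainSub t` (rank–nullity for `dMap` on even cochains). [folklore] -/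
theorem finrank_closedSub_add_dRank [Finite ι₀] [Finite ι₁] [Finite κ₀] [Finite κ₁]
    (L : AddSubgroup (Fin ν → ZMod m)) (t : ℤ) (M : GMFData F ν m ι₀ ι₁) (N : GMFData F ν m κ₀ κ₁) :
    finrank F (closedSub L t M N) + dRank L t M N = finrank F (cochainSub L t M N) := by
  rw [closedSub_eq_inf_ker, dRank]
  exact finrank_inf_ker_add_finrank_map _ _

/-- `dim (oddSub t ⊓ ker hMap) + hRank t = dim oddSub t` (rank–nullity for `hMap` on odd cochains). [folklore] -/
theorem finrank_oddKer_add_hRank [Finite ι₀] [Finite ι₁] [Finite κ₀] [Finite κ₁]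
    (L : AddSubgroup (Fin ν → ZMod m)) (t : ℤ) (M : GMFData F ν m ι₀ ι₁) (N : GMFData F ν m κ₀ κ₁) :
    finrank F ↥(oddSub L t M N ⊓ LinearMap.ker ((hMap M N).restrictScalars F)) + hRank L t M N =
      finrank F (oddSub L t M N) :=
  finrank_inf_ker_add_finrank_map _ _

variable [DecidableEq ι₀] [DecidableEq ι₁] [DecidableEq κ₀] [DecidableEq κ₁]

/-- **`homDim t + hRank t = dim closedSub t`** for a lawful pair (`null ⊆ closed`; the spans in the
definition of `homDim` are the subspaces themselves). [folklore] -/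
theorem homDim_add_hRank {L : AddSubgroup (Fin ν → ZMod m)} (M : GMF F ν m L ι₀ ι₁) (N : GMF F ν m L κ₀ κ₁)
    (t : ℤ) :
    homDim F L t M.toGMFData N.toGMFData + hRank L t M.toGMFData N.toGMFData =
      finrank F (closedSub L t M.toGMFData N.toGMFData) := by
  unfold homDim hRank
  rw [span_closedSet, span_nullSet]
  exact finrank_quotient_comap_add _ _ (nullSub_le_closedSub M N t)

/-- **`homDim t M N + dRank t + hRank t = dim cochainSub t`** for a lawful pair. [folklore] -/
theorem homDim_add_ranks {L : AddSubgroup (Fin ν → ZMod m)} (M : GMF F ν m L ι₀ ι₁) (N : GMF F ν m L κ₀ κ₁)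
    (t : ℤ) :
    homDim F L t M.toGMFData N.toGMFData + dRank L t M.toGMFData N.toGMFData +
        hRank L t M.toGMFData N.toGMFData = finrank F (cochainSub L t M.toGMFData N.toGMFData) := by
  have h1 := homDim_add_hRank M N t
  have h2 := finrank_closedSub_add_dRank L t M.toGMFData N.toGMFData
  omega

/-! ### The pair `(M, N[1])` -/

omit [DecidableEq ι₀] [DecidableEq ι₁] [DecidableEq κ₀] [DecidableEq κ₁] in
/-- `closed(M, N[1])_t ≅ oddSub_{t+m}(M, N) ∩ ker hMap` via `(s, u) ↦ (s, −u)`. [folklore] -/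
theorem closedSub_shift_map_negSnd (L : AddSubgroup (Fin ν → ZMod m)) (t : ℤ) (M : GMFData F ν m ι₀ ι₁)
    (N : GMFData F ν m κ₀ κ₁) :
    (closedSub L t M N.shift).map (negSnd F).toLinearMap =
      oddSub L (t + m) M N ⊓ LinearMap.ker ((hMap M N).restrictScalars F) := by
  ext w
  simp only [Submodule.mem_map, Submodule.mem_inf, LinearMap.mem_ker, LinearMap.coe_restrictScalars,
    LinearEquiv.coe_toLinearMap]
  constructor
  · rintro ⟨y, hy, rfl⟩
    rw [mem_closedSub, ← mem_cochainSub, cochainSub_shift, dMap_shift_apply] at hy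
    refine ⟨negSnd_mem_oddSub.mpr hy.1, ?_⟩
    have h2 := congrArg (negSnd F) hy.2
    simpa using h2
  · rintro ⟨h1, h2⟩
    refine ⟨negSnd F w, ?_, by simp⟩
    rw [mem_closedSub, ← mem_cochainSub, cochainSub_shift, dMap_shift_apply]
    refine ⟨negSnd_mem_oddSub.mpr (by simpa using h1), ?_⟩
    have hw : negSnd F (negSnd F w) = w := by simp
    rw [hw, h2, map_zero]

omit [DecidableEq ι₀] [DecidableEq ι₁] [DecidableEq κ₀] [DecidableEq κ₁] in
/-- `null(M, N[1])_t ≅ dMap (cochainSub_t (M, N))` via `(s, u) ↦ (s, −u)`. [folklore] -/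
theorem nullSub_shift_map_negSnd (L : AddSubgroup (Fin ν → ZMod m)) (t : ℤ) (M : GMFData F ν m ι₀ ι₁)
    (N : GMFData F ν m κ₀ κ₁) :
    (nullSub L t M N.shift).map (negSnd F).toLinearMap =
      (cochainSub L t M N).map ((dMap M N).restrictScalars F) := by
  ext w
  simp only [Submodule.mem_map, LinearMap.coe_restrictScalars, LinearEquiv.coe_toLinearMap]
  constructor
  · rintro ⟨y, hy, rfl⟩
    rw [mem_nullSub] at hy
    obtain ⟨su, hsu, rfl⟩ := hy
    rw [← mem_oddSub, oddSub_shift] at hsu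
    refine ⟨negSnd F su, negSnd_mem_cochainSub.mpr hsu, ?_⟩
    rw [hMap_shift_apply, negSnd_negSnd]
  · rintro ⟨z, hz, rfl⟩
    refine ⟨negSnd F (dMap M N z), ?_, negSnd_negSnd F _⟩
    rw [mem_nullSub]
    refine ⟨negSnd F z, ?_, ?_⟩
    · rw [← mem_oddSub, oddSub_shift]
      exact negSnd_mem_cochainSub.mpr hz
    · rw [hMap_shift_apply, negSnd_negSnd]

omit [DecidableEq ι₀] [DecidableEq ι₁] [DecidableEq κ₀] [DecidableEq κ₁] in
/-- `dim closed(M, N[1])_t = dim (oddSub_{t+m} ∩ ker hMap)`. [folklore] -/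
theorem finrank_closedSub_shift [Finite ι₀] [Finite ι₁] [Finite κ₀] [Finite κ₁]
    (L : AddSubgroup (Fin ν → ZMod m)) (t : ℤ) (M : GMFData F ν m ι₀ ι₁) (N : GMFData F ν m κ₀ κ₁) :
    finrank F (closedSub L t M N.shift) =
      finrank F ↥(oddSub L (t + m) M N ⊓ LinearMap.ker ((hMap M N).restrictScalars F)) := by
  rw [← LinearEquiv.finrank_map_eq (negSnd F) (closedSub L t M N.shift), closedSub_shift_map_negSnd]

omit [DecidableEq ι₀] [DecidableEq ι₁] [DecidableEq κ₀] [DecidableEq κ₁] in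
/-- `hRank t (M, N[1]) = dRank t (M, N)`. [folklore] -/
theorem hRank_shift (L : AddSubgroup (Fin ν → ZMod m)) (t : ℤ) (M : GMFData F ν m ι₀ ι₁)
    (N : GMFData F ν m κ₀ κ₁) : hRank L t M N.shift = dRank L t M N := by
  unfold hRank dRank
  rw [← LinearEquiv.finrank_map_eq (negSnd F) (nullSub L t M N.shift), nullSub_shift_map_negSnd]

/-- **`homDim t M N[1] + dRank t + hRank (t + m) = dim oddSub (t + m)`** for a lawful pair. [folklore] -/
theorem homDim_shift_add_ranks {L : AddSubgroup (Fin ν → ZMod m)} (M : GMF F ν m L ι₀ ι₁)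
    (N : GMF F ν m L κ₀ κ₁) (t : ℤ) :
    homDim F L t M.toGMFData N.toGMFData.shift + dRank L t M.toGMFData N.toGMFData +
        hRank L (t + m) M.toGMFData N.toGMFData = finrank F (oddSub L (t + m) M.toGMFData N.toGMFData) := by
  have h1 := homDim_add_hRank M N.shift t
  rw [GMF.shift_toGMFData, hRank_shift, finrank_closedSub_shift] at h1
  have h2 := finrank_oddKer_add_hRank L (t + m) M.toGMFData N.toGMFData
  omega

/-- **The summand of the Euler form as ranks**: for a lawful pair,
`homDim (jm) M N − homDim (jm) M N[1] = dim C_{jm} − dim C'_{(j+1)m} − hRank_{jm} + hRank_{(j+1)m}`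
— the rank of the even differential cancels. [folklore] -/
theorem eulerSummand_eq {L : AddSubgroup (Fin ν → ZMod m)} (M : GMF F ν m L ι₀ ι₁) (N : GMF F ν m L κ₀ κ₁)
    (j : ℤ) :
    ((homDim F L (j * m) M.toGMFData N.toGMFData : ℤ) -
        (homDim F L (j * m) M.toGMFData N.toGMFData.shift : ℤ)) =
      (finrank F (cochainSub L (j * m) M.toGMFData N.toGMFData) : ℤ) -
        (finrank F (oddSub L (j * m + m) M.toGMFData N.toGMFData) : ℤ) -
        (hRank L (j * m) M.toGMFData N.toGMFData : ℤ) + (hRank L (j * m + m) M.toGMFData N.toGMFData : ℤ) := by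
  have h1 := homDim_add_ranks M N (j * m)
  have h2 := homDim_shift_add_ranks M N (j * m)
  omega

end GMFData

/-- **Registered sub-goal: `homDim` of a lawful pair is a difference of ranks**,
`homDim t M N + dRank t + hRank t = dim cochainSub t`. [folklore] -/
theorem homDim_add_dRank_add_hRank : ∀ (F : Type) [Field F] (ν m : ℕ) (L : AddSubgroup (Fin ν → ZMod m))
    (ι₀ ι₁ κ₀ κ₁ : Type) [Fintype ι₀] [Fintype ι₁] [Fintype κ₀] [Fintype κ₁] [DecidableEq ι₀]
    [DecidableEq ι₁] [DecidableEq κ₀] [DecidableEq κ₁] (M : GMF F ν m L ι₀ ι₁) (N : GMF F ν m L κ₀ κ₁)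
    (t : ℤ), GMFData.homDim F L t M.toGMFData N.toGMFData + GMFData.dRank L t M.toGMFData N.toGMFData +
      GMFData.hRank L t M.toGMFData N.toGMFData =
        Module.finrank F (GMFData.cochainSub L t M.toGMFData N.toGMFData) :=
  fun _ _ _ _ _ _ _ _ _ _ _ _ _ _ _ _ _ M N t ↦ GMFData.homDim_add_ranks M N t

end Summit.HodgeConjecture.HodgeConjecture.Cruxes.FermatAnchorAssembly.WittLiftRigidMf

end
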